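import Summits.CriticalPhenomena.PercolationContinuityZ3.Theorems.PercNearOneGluingNoHeavyLowerTailHullPortTADefs
import Literature.Probability.Percolation.TwoSetConditionalAssociationRC
import Literature.Probability.LatticeModels.RandomClusterEdgeWeights
import HarnessLib

/-!
# FK sub-lane: the hull-port `T_A` functionals for the random-cluster measure `φ_{𝐩,q}` (definitions)

Definitions file (`--supports stmt-CriticalPhenomena-4575`), FK sub-lane `prim-bschramm-fk-2` (gen 3); builds on p205010 (kernel
theorem, internal audit signed; external expert review pending).  No theorems, no named facts, no sorries.

These are the random-cluster analogues of prove-5's `HullPort.ta*` functionals (`…HullPortTADefs.lean`, product measure,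
prim-hp-7's proof of `T_A ≥ 0`, HP7-MDLX-PROOF.md §0), in the SAME sum-level "avoided SET `X`, deleted pairs" bookkeeping,
with two substitutions (bschramm/FK-Q2.md §12.1, §12.7):
* the weight of a configuration is the free random-cluster weight `rcWeightW w q ∅ ω = (∏_e …)·q^{k(ω)}` (Grimmett (1.20)) in
  place of `BHK2006.weight`;
* the "world" expectation in the deleted graph `G − B` is the normalised random-cluster expectation with the pairs of `B` given
  parameter `0` and the SAME `q`:  `wE w q B φ = Σ_η rcMass (delW w B) q η · φ η`  (van den Berg–Häggström–Kahn's Lemma 2.3 for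
  the random-cluster measure: given the cluster of `X`, the configuration off the pairs meeting it is `φ_{G − X̄, q}`; tree
  `rc_sum_setCl_eq`), in place of `HullPort.delE`.
The cut set `HullPort.cut X ω` (pairs meeting the open vertex cluster of `X`) and the avoidance events `HullPort.avoidEv` are
measure-free and are reused.  With `K̄ = cut X ω`: `FK.taC` (`c_K = Cov_{φ_{G−K̄,q}}(g(C_s), 1{s↔y})`), `FK.taN`
(`φ_{G−K̄,q}(s↮y)`), `FK.taNW` (`φ_{G−K̄,q}(s↮y, y↔z)`), `FK.taB = Σ_ω w_q(ω) 1_{s↮X} c`, `FK.taA = Σ_ω w_q(ω) 1_{s↮X} (taNW/taN) c`,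
`FK.tab = Z·φ(y↮s, y↮X)`, `FK.taa = Z·φ(y↮s, y↮X, y↔z)`, `FK.taQ = taA·tab − taa·taB` (`= Z²·b·T_A`).  Contraction of a pair
`e = s(x₀,v)` at `X` is encoded by the weight vector `Function.update w e 1` together with the avoided set `X ∪ {v}` (a weight-1
pair is almost surely open for `φ_{𝐩,q}`), deletion by `Function.update w e 0` — so all states live on one vertex type.
[cite: Grimmett2006, §1.4 eq. (1.20) (p. 15)] [cite: VandenbergHaggstromKahn2005, §2.1 Lemma 2.3 (p. 10); §1 pp. 3–5]
-/

noncomputable section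

namespace Summit.CriticalPhenomena.PercolationContinuityZ3.Theorems.FK

open MeasureTheory Set Literature.Probability.LatticeModels Literature.Probability.Percolation
open Literature.Probability.Percolation.DecisionTree (ind)
open Literature.Probability.Percolation.BHK2006 (rcMass delW)
open Summit.CriticalPhenomena.PercolationContinuityZ3.Theorems.HullPort (cut avoidEv)
open scoped Classical

variable {V : Type*} [Fintype V]

/-- `E_{φ_{G − B, q}}[φ]`: expectation of `φ` under the free random-cluster measure with the pairs of `B` given parameter `0`
(the "world" `G − B`, same `q`). [cite: VandenbergHaggstromKahn2005, §2.1 Lemma 2.3 (p. 10)] -/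
def wE (w : Sym2 V → unitInterval) (q : ℝ) (B : Set (Sym2 V)) (φ : Set (Sym2 V) → ℝ) : ℝ :=
  ∑ η, rcMass (delW w B) q η * φ η

/-- `c(ω) = Cov_{φ_{G − cut_X(ω), q}}(g(C_s), 1{s ↔ y})` (the memo's `c_K`, `K = C_X(ω)`, for `φ_{𝐩,q}`).
(transcription of prim-hp-7 HP7-MDLX-PROOF.md §0 with FK worlds) [cite: VandenbergHaggstromKahn2005, §2.1 Lemma 2.3 (p. 10)] -/
def taC (w : Sym2 V → unitInterval) (q : ℝ) (s y : V) (X : Set V) (g : Set (Sym2 V) → ℝ) (ω : Set (Sym2 V)) : ℝ :=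
  wE w q (cut X ω) (fun η => g (openEdgeCluster η s) * ind (openConn s y) η) -
    wE w q (cut X ω) (fun η => g (openEdgeCluster η s)) * wE w q (cut X ω) (ind (openConn s y))

/-- `φ_{G − cut_X(ω), q}(s ↮ y)` (the memo's `P_K(N)`). [cite: VandenbergHaggstromKahn2005, §2.1 Lemma 2.3 (p. 10)] -/
def taN (w : Sym2 V → unitInterval) (q : ℝ) (s y : V) (X : Set V) (ω : Set (Sym2 V)) : ℝ :=
  wE w q (cut X ω) (ind (openConn s y : Set (BondConfig V))ᶜ)

/-- `φ_{G − cut_X(ω), q}(s ↮ y, y ↔ z)` (the memo's `P_K(W ∩ N)`). [cite: VandenbergHaggstromKahn2005, §2.1 Lemma 2.3 (p. 10)] -/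
def taNW (w : Sym2 V → unitInterval) (q : ℝ) (s y z : V) (X : Set V) (ω : Set (Sym2 V)) : ℝ :=
  wE w q (cut X ω) (ind ((openConn s y : Set (BondConfig V))ᶜ ∩ openConn y z))

/-- `B = Σ_ω w_q(ω)·1{s ↮ X}·c(ω)` (unnormalised: `w_q = rcWeightW w q ∅`). (transcription of prim-hp-7 HP7-MDLX-PROOF.md §0 for `φ_{𝐩,q}`)
[cite: Grimmett2006, §1.4 eq. (1.20) (p. 15)] -/
def taB (w : Sym2 V → unitInterval) (q : ℝ) (s y : V) (X : Set V) (g : Set (Sym2 V) → ℝ) : ℝ :=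
  ∑ ω, rcWeightW w q ∅ ω * (ind (avoidEv s X) ω * taC w q s y X g ω)

/-- `A = Σ_ω w_q(ω)·1{s ↮ X}·(taNW/taN)(ω)·c(ω)` (unnormalised). (transcription of prim-hp-7 HP7-MDLX-PROOF.md §0 for `φ_{𝐩,q}`)
[cite: Grimmett2006, §1.4 eq. (1.20) (p. 15)] -/
def taA (w : Sym2 V → unitInterval) (q : ℝ) (s y z : V) (X : Set V) (g : Set (Sym2 V) → ℝ) : ℝ :=
  ∑ ω, rcWeightW w q ∅ ω * (ind (avoidEv s X) ω * (taNW w q s y z X ω / taN w q s y X ω * taC w q s y X g ω))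

/-- `b = Z·φ(y ↮ s, y ↮ X)` (unnormalised mass of the avoidance event). [cite: Grimmett2006, §1.4 eq. (1.20) (p. 15)] -/
def tab (w : Sym2 V → unitInterval) (q : ℝ) (s y : V) (X : Set V) : ℝ :=
  ∑ ω, rcWeightW w q ∅ ω * ind (avoidEv y (insert s X)) ω

/-- `a = Z·φ(y ↮ s, y ↮ X, y ↔ z)` (unnormalised). [cite: Grimmett2006, §1.4 eq. (1.20) (p. 15)] -/
def taa (w : Sym2 V → unitInterval) (q : ℝ) (s y z : V) (X : Set V) : ℝ :=
  ∑ ω, rcWeightW w q ∅ ω * ind (avoidEv y (insert s X) ∩ openConn y z) ω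

/-- `Q = A·b − a·B` (`= Z²·b·T_A` of the memo, for `φ_{𝐩,q}`). (transcription of prim-hp-7 HP7-MDLX-PROOF.md §0 (F1) for `φ_{𝐩,q}`)
[cite: Grimmett2006, §1.4 eq. (1.20) (p. 15)] -/
def taQ (w : Sym2 V → unitInterval) (q : ℝ) (s y z : V) (X : Set V) (g : Set (Sym2 V) → ℝ) : ℝ :=
  taA w q s y z X g * tab w q s y X - taa w q s y z X * taB w q s y X g

end Summit.CriticalPhenomena.PercolationContinuityZ3.Theorems.FK

end
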